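import Mathlib.Topology.Algebra.OpenSubgroup
import Literature.AnabelianGeometry.SemiGraphs.TemperedReconstruction
import Literature.AnabelianGeometry.SemiGraphs.TemperedMaximalCompact
import HarnessLib

/-!
# Semi-graphs of anabelioids, §3: Corollary 3.9, step (b) — a quasi-geometric homomorphism
# determines the map on vertices (toward residual R2 of the reduction)

Mochizuki, *Semi-graphs of anabelioids*, Publ. RIMS **42** (2006), §3, Corollary 3.9, proof,
manuscript p. 42 [cite: MochizukiSemiAnbd2006, Cor 3.9 p.42]: "by Proposition 3.2; Definition 3.8;
Theorem 3.7, (ii), (iii), any quasi-geometric `φ : B^temp(G) → B^temp(H)` determines a map from the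
vertices of `G` to the vertices of `H` — i.e., by considering the unique [conjugacy class of]
verticial subgroup(s) of `π₁^temp(H)` that contain(s) the image of a given verticial subgroup of
`π₁^temp(G)`."  Proof-only (no definitions): from the typed named facts Theorem 3.7 (i)
`VerticialInjective`, (ii) `VerticialDistinct`, (iv) `MaximalCompactIffVerticial`, a quasi-geometric
`φ` determines a UNIQUE map `f_V` on vertices such that every verticial subgroup at `v` is carried
onto an open subgroup of a verticial subgroup at `f_V(v)` (`existsUnique_vertexMap_of_isQuasiGeometric`).
Key step (`vertex_eq_of_mapsOnto_of_le`): the image of a verticial subgroup is open, hence of finite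
index, in a verticial subgroup at `w`; if it also lies in a verticial subgroup at `w'`, the two
verticial subgroups have an intersection of finite index in the first, which Thm. 3.7 (ii) forbids
unless `w = w'`.  This is the vertex half of the residual `QuasiGeometricGraphData` (R2) of
`TemperedReconstructionReductions.lean`; the edge half wants the edge analogue of Thm. 3.7 (ii)
(abc-iut-L3-d2's `EdgeLikeDistinct`).  Nothing here takes a side on [IUTchIII] Cor. 3.12.
-/

open CategoryTheory Topology

namespace Literature.AnabelianGeometry.SemiGraphs

namespace ProfiniteSemiGraph

universe u

variable {𝒢 ℋ : ProfiniteSemiGraph.{u}}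

/-- A subgroup mapped "surjectively onto an open subgroup of" a COMPACT subgroup `K₂`
(`MapsOntoOpenSubgroupOf`) has image of finite index in `K₂`. [cite: MochizukiSemiAnbd2006, Def 3.8 p.42] -/
theorem relIndex_ne_zero_of_mapsOnto {P Γ : Type u} [Group P] [Group Γ] [TopologicalSpace Γ]
    [IsTopologicalGroup Γ] (φ : P →* Γ) {K : Subgroup P} {K₂ : Subgroup Γ}
    (hK₂ : IsCompact (K₂ : Set Γ)) (h : MapsOntoOpenSubgroupOf φ K K₂) :
    (K.map φ).relIndex K₂ ≠ 0 := by
  haveI : CompactSpace K₂ := isCompact_iff_compactSpace.mp hK₂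
  have hopen : IsOpen (((K.map φ).subgroupOf K₂ : Subgroup K₂) : Set K₂) := h.2
  haveI := Subgroup.quotient_finite_of_isOpen _ hopen
  exact Subgroup.index_ne_zero_of_finite

/-- **The vertex is determined** (Thm. 3.7 (ii), clause 1): if `φ` maps `K` onto an open subgroup of
a verticial subgroup `K₂` at `w`, and `φ(K)` also lies in a verticial subgroup `K₂'` at `w'`, then
`w = w'`. [cite: MochizukiSemiAnbd2006, Cor 3.9 p.42] -/
theorem vertex_eq_of_mapsOnto_of_le (h37ii : VerticialDistinct.{u}) (hℋ : ℋ.Thm37Hypotheses)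
    {P : Type u} [Group P] (cℋ : TemperedPiChart ℋ) (φ : P →* cℋ.G) {K : Subgroup P}
    {w w' : ℋ.graph.Vertex} {K₂ K₂' : Subgroup cℋ.G} (hK₂ : K₂ ∈ verticialSubgroups cℋ w)
    (hK₂' : K₂' ∈ verticialSubgroups cℋ w') (hmaps : MapsOntoOpenSubgroupOf φ K K₂)
    (hle : K.map φ ≤ K₂') : w = w' := by
  have h1 : (K.map φ).relIndex K₂ ≠ 0 :=
    relIndex_ne_zero_of_mapsOnto φ (isCompact_of_mem_verticialSubgroups cℋ hK₂) hmaps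
  have h2 : K₂'.relIndex K₂ ≠ 0 := fun h0 => h1 (Subgroup.relIndex_eq_zero_of_le_left hle h0)
  by_contra hne
  exact h2 ((h37ii ℋ hℋ cℋ).1 w w' K₂ K₂' hK₂ hK₂' hne)

/-- **A quasi-geometric `φ` determines the map on vertices** ([SemiAnbd] Cor. 3.9, proof, p. 42),
from Thm. 3.7 (i), (ii), (iv): there is a unique `f_V : V(G) → V(H)` such that every verticial
subgroup of `π₁^temp(G)` at `v` maps onto an open subgroup of some verticial subgroup of `π₁^temp(H)`
at `f_V(v)`. [cite: MochizukiSemiAnbd2006, Cor 3.9 p.42] -/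
theorem existsUnique_vertexMap_of_isQuasiGeometric (h37i : VerticialInjective.{u})
    (h37ii : VerticialDistinct.{u}) (h37iv : MaximalCompactIffVerticial.{u})
    (h𝒢 : 𝒢.Thm37Hypotheses) (hℋ : ℋ.Thm37Hypotheses) (c𝒢 : TemperedPiChart 𝒢)
    (cℋ : TemperedPiChart ℋ) (φ : c𝒢.G →ₜ* cℋ.G) (hφ : IsQuasiGeometric φ) :
    ∃! fV : 𝒢.graph.Vertex → ℋ.graph.Vertex,
      ∀ (v : 𝒢.graph.Vertex) (K : Subgroup c𝒢.G), K ∈ verticialSubgroups c𝒢 v →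
        ∃ K₂ ∈ verticialSubgroups cℋ (fV v), MapsOntoOpenSubgroupOf φ.toMonoidHom K K₂ := by
  obtain ⟨hmax𝒢, -⟩ := h37iv 𝒢 h𝒢 c𝒢
  obtain ⟨hmaxℋ, -⟩ := h37iv ℋ hℋ cℋ
  -- the image of a verticial subgroup lies, as an open subgroup, in a verticial subgroup
  have himg : ∀ (v : 𝒢.graph.Vertex) (K : Subgroup c𝒢.G), K ∈ verticialSubgroups c𝒢 v →
      ∃ (w : ℋ.graph.Vertex) (K₂ : Subgroup cℋ.G), K₂ ∈ verticialSubgroups cℋ w ∧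
        MapsOntoOpenSubgroupOf φ.toMonoidHom K K₂ := by
    intro v K hK
    obtain ⟨K₂, hK₂, hmaps⟩ := hφ.maximal K ((hmax𝒢 K).mpr ⟨v, hK⟩)
    obtain ⟨w, hK₂w⟩ := (hmaxℋ K₂).mp hK₂
    exact ⟨w, K₂, hK₂w, hmaps⟩
  -- choose, for each `v`, a verticial subgroup and the vertex of its image
  have hne : ∀ v : 𝒢.graph.Vertex, (verticialSubgroups c𝒢 v).Nonempty := fun v => (h37i 𝒢 h𝒢 c𝒢 v).1
  choose K₀ hK₀ using hne
  choose fV K₂ hK₂ hmaps using fun v => himg v (K₀ v) (hK₀ v)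
  -- any verticial subgroup at `v` goes to the same vertex
  have hall : ∀ (v : 𝒢.graph.Vertex) (K : Subgroup c𝒢.G), K ∈ verticialSubgroups c𝒢 v →
      ∃ K₂' ∈ verticialSubgroups cℋ (fV v), MapsOntoOpenSubgroupOf φ.toMonoidHom K K₂' := by
    intro v K hK
    obtain ⟨w, K₂', hK₂', hmaps'⟩ := himg v K hK
    -- `K = g K₀ g⁻¹`, so `φ(K) = φ(g) φ(K₀) φ(g)⁻¹ ≤ φ(g) K₂ φ(g)⁻¹`, verticial at `fV v`
    obtain ⟨g, rfl⟩ := exists_conj_of_mem_verticialSubgroups c𝒢 (hK₀ v) hK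
    have hle : ((K₀ v).map (MulAut.conj g).toMonoidHom).map φ.toMonoidHom ≤
        (K₂ v).map (MulAut.conj (φ g)).toMonoidHom := by
      rintro _ ⟨_, ⟨k, hk, rfl⟩, rfl⟩
      refine ⟨φ k, (hmaps v).1 ⟨k, hk, rfl⟩, ?_⟩
      change φ g * φ k * (φ g)⁻¹ = φ (g * k * g⁻¹)
      rw [map_mul, map_mul, map_inv]
    have hw : w = fV v :=
      vertex_eq_of_mapsOnto_of_le h37ii hℋ cℋ φ.toMonoidHom hK₂' (conj_mem_verticialSubgroups cℋ
        (hK₂ v) (φ g)) hmaps' hle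
    subst hw
    exact ⟨K₂', hK₂', hmaps'⟩
  refine ⟨fV, hall, fun fV' hfV' => funext fun v => ?_⟩
  obtain ⟨K₂', hK₂', hmaps'⟩ := hfV' v (K₀ v) (hK₀ v)
  exact vertex_eq_of_mapsOnto_of_le h37ii hℋ cℋ φ.toMonoidHom hK₂' (hK₂ v) hmaps' (hmaps v).1

end ProfiniteSemiGraph

end Literature.AnabelianGeometry.SemiGraphs
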